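import Summits.Ventures.HSemireg.WeilFramePureWeilEuler
/-!
# Venture HSemireg — ADAPTED FRAMES WITHOUT A POLARISATION: every `(V; L; P, Q)` with the Weil dimension data carries SOME
# non-degenerate Weil 2-vector, so the PURE WEIL CLASSES need no polarisation hypothesis at all

HONEST FRAMING. Part of the Lean index of the computation cell `pub-hsemireg` (seat w3-mod4-1 gen 9, W3 SPECIAL FIBRES,
MOD4-OFFSPLIT §13). Finite-dimensional linear / exterior algebra plus the tree's real carriers and the Literature's Weil-type layer
ONLY: no semiregularity map is constructed; nothing here says that HC / HC_CM / HC_AV holds; nothing here is a claim about any explicit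
variety; no Literature fact is declared; NO definition is introduced.

WHAT IS PROVED. The frame-free theorems of FILES 4–17 take the polarisation 2-vector `Θ` (or, on the real carrier, a `K`-symmetric
`(1,1)`-class `h` with `ĥ^{2n} ≠ 0`) as input because the adapted frame is built from it (`exists_adapted_basis`). For the PURE Weil
classes `w₊ + w₋`, `w₊`, `w₋` the contraction spans do not involve `Θ` at all, and here the frame is built from the subspace data
alone: **`exists_adapted_basis_free`** — `dim V = 2(p + r)`, `dim L = p + r`, `P`, `Q` disjoint with `dim P = dim Q = p + r`,
`dim (L ⊓ Q) = p`, `dim (L ⊓ P) = r` ⇒ there is a basis `bV` (`Fin ((p + r) + (p + r))`) with `Lsp bV = L`, `ℓ_a ∈ Q, m_a ∈ P`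
(`a < p`), `ℓ_a ∈ P, m_a ∈ Q` (`a ≥ p`) (bases of `L ⊓ Q`, `L ⊓ P` completed by bases of complements of `L ⊓ P` in `P` and of
`L ⊓ Q` in `Q`; independence from `P ⊓ Q = 0` and the two complementary pairs); **`exists_weilGen_twoVector`** — hence SOME `Θ` in the
span of the Weil generating set of `(L; P, Q)` and non-degenerate on `L^⊥` exists (gen 8's converse lemmas
`sum_ι_mul_ι_mem_span_weilGen`, `ι_mem_span_contractLeft_sum`). CONSEQUENCES (type `(n, n)`, char `0`, `n ≥ 1`): the pure-Weil
theorems of FILES 16/17 WITHOUT ANY POLARISATION HYPOTHESIS — `finrank_S_pureWeilBlocks_all` / `_zero` / `_top` / `_one_all` /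
`_low_all`, `alternating_sum_finrank_S_pureWeilBlocks` (abstract blocks), and on the real carrier, for `A` of dimension `2n`,
`φ ≫ φ = -(d • 𝟙 A)`, `d ≥ 1`, `P, Q` the `±i√d`-eigenspaces with `dim (P ⊓ H^{1,0}) = n`, and non-zero Weil classes `c± ∈ E±` —
NOTHING ELSE: **`finrank_S_weilLineClasses_all`** (`dim S_k(ĉ₊ + ĉ₋) = 2·C(2n,k)`, `1 ≤ k ≤ 2n - 1`), **`…_zero` / `…_top`** (`= 1`),
**`finrank_S_weilLineClass_plus_all` / `_minus_all`** (`dim S_k(ĉ±) = C(2n,k)`, `0 ≤ k ≤ 2n`),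
**`alternating_sum_finrank_S_weilLineClasses`** (`= -2`). Everything PROVED, 0 sorry.
References: [BourbakiAlgebre1a3] Ch. II §7 no. 5 (complements, bases), Ch. III §11 no. 9; [vanGeemen1994HodgeAV] 4.9;
[BuchweitzFlenner2008HH] Prop. 6.4.4 (why these operators).
-/

noncomputable section
open CliffordAlgebra (contractLeft)
open ExteriorAlgebra (ι)
open Module CategoryTheory
open Literature.AlgebraicGeometry.Motives Literature.AlgebraicGeometry.HodgeTheory
open Literature.AlgebraicTopology.SingularHomology
namespace Summit.Ventures.HSemireg.WeilFrame
open Summit.Ventures.HSemireg.WedgeBridge Summit.Ventures.HSemireg.WeilCarrier Summit.Ventures.HSemireg.Mod4Carrier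

/-! ### 1. An adapted frame from the subspace data alone -/
section Free
variable {K : Type*} [Field K] {V : Type*} [AddCommGroup V] [Module K V]

/-- **ADAPTED FRAMES EXIST WITHOUT A POLARISATION:** `dim V = 2(p + r)`, `dim L = p + r`, `P`, `Q` disjoint of dimension `p + r`
each, `dim (L ⊓ Q) = p`, `dim (L ⊓ P) = r` ⇒ a basis `bV` with `Lsp bV = L`, `ℓ_a ∈ Q, m_a ∈ P` for `a < p` and `ℓ_a ∈ P, m_a ∈ Q`
for `a ≥ p`. [cite: BourbakiAlgebre1a3, Ch. II §7 no. 5] -/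
theorem exists_adapted_basis_free [FiniteDimensional K V] {p r : ℕ} {L P Q : Submodule K V}
    (hV : finrank K V = (p + r) + (p + r)) (hPQ : Disjoint P Q) (hL : finrank K L = p + r)
    (hLQ : finrank K ↥(L ⊓ Q) = p) (hLP : finrank K ↥(L ⊓ P) = r) (hP : finrank K ↥P = p + r)
    (hQ : finrank K ↥Q = p + r) :
    ∃ bV : Basis (Fin ((p + r) + (p + r))) K V, Lsp bV = L ∧
      (∀ a : Fin (p + r), (a : ℕ) < p → ℓ bV a ∈ Q ∧ m bV a ∈ P) ∧
      (∀ a : Fin (p + r), p ≤ (a : ℕ) → ℓ bV a ∈ P ∧ m bV a ∈ Q) := by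
  -- bases of `L ⊓ Q` (size `p`) and `L ⊓ P` (size `r`)
  let bQ : Basis (Fin p) K ↥(L ⊓ Q) := (Module.finBasis K ↥(L ⊓ Q)).reindex (finCongr hLQ)
  let bP : Basis (Fin r) K ↥(L ⊓ P) := (Module.finBasis K ↥(L ⊓ P)).reindex (finCongr hLP)
  -- complements: `C` of `L ⊓ P` inside `P` (size `p`), `D` of `L ⊓ Q` inside `Q` (size `r`)
  obtain ⟨C, hC⟩ := Submodule.exists_isCompl ((L ⊓ P).comap P.subtype)
  obtain ⟨D, hD⟩ := Submodule.exists_isCompl ((L ⊓ Q).comap Q.subtype)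
  have hP' : finrank K ↥((L ⊓ P).comap P.subtype) = r := by
    rw [LinearEquiv.finrank_eq (Submodule.comapSubtypeEquivOfLe (inf_le_right : L ⊓ P ≤ P)), hLP]
  have hQ' : finrank K ↥((L ⊓ Q).comap Q.subtype) = p := by
    rw [LinearEquiv.finrank_eq (Submodule.comapSubtypeEquivOfLe (inf_le_right : L ⊓ Q ≤ Q)), hLQ]
  have hCd : finrank K ↥C = p := by
    have h := Submodule.finrank_add_eq_of_isCompl hC
    rw [hP', finrank_eq_card_basis ((Module.finBasis K ↥P).reindex (finCongr hP)), Fintype.card_fin] at h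
    omega
  have hDd : finrank K ↥D = r := by
    have h := Submodule.finrank_add_eq_of_isCompl hD
    rw [hQ', finrank_eq_card_basis ((Module.finBasis K ↥Q).reindex (finCongr hQ)), Fintype.card_fin] at h
    omega
  let bC : Basis (Fin p) K ↥C := (Module.finBasis K ↥C).reindex (finCongr hCd)
  let bD : Basis (Fin r) K ↥D := (Module.finBasis K ↥D).reindex (finCongr hDd)
  let ℓf : Fin (p + r) → V := Fin.append (fun i => (bQ i : V)) (fun j => (bP j : V))
  let mf : Fin (p + r) → V := Fin.append (fun i => ((bC i : ↥P) : V)) (fun j => ((bD j : ↥Q) : V))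
  have hℓL : ∀ a, ℓf a ∈ L := by
    intro a
    by_cases h : (a : ℕ) < p
    · rw [show a = Fin.castAdd r ⟨a, h⟩ from Fin.ext rfl]; simp only [ℓf, Fin.append_left]; exact (bQ _).2.1
    · rw [show a = Fin.natAdd p ⟨a - p, by omega⟩ from Fin.ext (by simp only [Fin.natAdd_mk]; omega)]; simp only [ℓf, Fin.append_right]
      exact (bP _).2.1
  have hliQ : LinearIndependent K (fun i => (bQ i : V)) :=
    bQ.linearIndependent.map' (L ⊓ Q).subtype (Submodule.ker_subtype _)
  have hliP : LinearIndependent K (fun j => (bP j : V)) :=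
    bP.linearIndependent.map' (L ⊓ P).subtype (Submodule.ker_subtype _)
  have hliC : LinearIndependent K (fun i => (bC i : ↥P)) :=
    bC.linearIndependent.map' C.subtype (Submodule.ker_subtype _)
  have hliD : LinearIndependent K (fun j => (bD j : ↥Q)) :=
    bD.linearIndependent.map' D.subtype (Submodule.ker_subtype _)
  have hli : LinearIndependent K (Fin.append ℓf mf) := by
    rw [Fintype.linearIndependent_iff]
    intro g hg
    rw [Fin.sum_univ_add] at hg
    simp only [Fin.append_left, Fin.append_right] at hg
    rw [Fin.sum_univ_add, Fin.sum_univ_add] at hg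
    simp only [ℓf, mf, Fin.append_left, Fin.append_right] at hg
    set SQ := ∑ i : Fin p, g (Fin.castAdd (p + r) (Fin.castAdd r i)) • (bQ i : V) with hSQ
    set SP := ∑ j : Fin r, g (Fin.castAdd (p + r) (Fin.natAdd p j)) • (bP j : V) with hSP
    set cC : ↥P := ∑ i : Fin p, g (Fin.natAdd (p + r) (Fin.castAdd r i)) • (bC i : ↥P) with hcC
    set cD : ↥Q := ∑ j : Fin r, g (Fin.natAdd (p + r) (Fin.natAdd p j)) • (bD j : ↥Q) with hcD
    have hSC : ∑ i : Fin p, g (Fin.natAdd (p + r) (Fin.castAdd r i)) • ((bC i : ↥P) : V) = (cC : V) := by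
      rw [hcC, Submodule.coe_sum]; rfl
    have hSD : ∑ j : Fin r, g (Fin.natAdd (p + r) (Fin.natAdd p j)) • ((bD j : ↥Q) : V) = (cD : V) := by
      rw [hcD, Submodule.coe_sum]; rfl
    rw [hSC, hSD] at hg
    have hSQm : SQ ∈ L ⊓ Q := Submodule.sum_mem _ fun i _ => Submodule.smul_mem _ _ (bQ i).2
    have hSPm : SP ∈ L ⊓ P := Submodule.sum_mem _ fun j _ => Submodule.smul_mem _ _ (bP j).2
    have hcCm : cC ∈ C := Submodule.sum_mem _ fun i _ => Submodule.smul_mem _ _ (bC i).2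
    have hcDm : cD ∈ D := Submodule.sum_mem _ fun j _ => Submodule.smul_mem _ _ (bD j).2
    have hPpart : SP + (cC : V) = 0 := by
      refine (Submodule.disjoint_def.mp hPQ) _ (P.add_mem hSPm.2 cC.2) ?_
      have : SP + (cC : V) = -(SQ + (cD : V)) := by rw [eq_neg_iff_add_eq_zero, ← hg]; abel
      rw [this]
      exact Q.neg_mem (Q.add_mem hSQm.2 cD.2)
    have hQpart : SQ + (cD : V) = 0 := by
      have h := hg
      rw [show SQ + SP + ((cC : V) + (cD : V)) = (SP + (cC : V)) + (SQ + (cD : V)) by abel, hPpart, zero_add] at h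
      exact h
    have hcC0 : cC = 0 := by
      have hmem : cC ∈ (L ⊓ P).comap P.subtype := by
        rw [Submodule.mem_comap, Submodule.subtype_apply,
          show (cC : V) = -SP from eq_neg_of_add_eq_zero_right hPpart]
        exact (L ⊓ P).neg_mem hSPm
      have h := hC.disjoint
      rw [Submodule.disjoint_def] at h
      exact h cC hmem hcCm
    have hSP0 : SP = 0 := by
      have h := hPpart
      rw [hcC0, Submodule.coe_zero, add_zero] at h
      exact h
    have hcD0 : cD = 0 := by
      have hmem : cD ∈ (L ⊓ Q).comap Q.subtype := by
        rw [Submodule.mem_comap, Submodule.subtype_apply,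
          show (cD : V) = -SQ from eq_neg_of_add_eq_zero_right hQpart]
        exact (L ⊓ Q).neg_mem hSQm
      have h := hD.disjoint
      rw [Submodule.disjoint_def] at h
      exact h cD hmem hcDm
    have hSQ0 : SQ = 0 := by
      have h := hQpart
      rw [hcD0, Submodule.coe_zero, add_zero] at h
      exact h
    have gQ := Fintype.linearIndependent_iff.mp hliQ _ hSQ0
    have gP := Fintype.linearIndependent_iff.mp hliP _ hSP0
    have gC := Fintype.linearIndependent_iff.mp hliC _ hcC0
    have gD := Fintype.linearIndependent_iff.mp hliD _ hcD0
    intro c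
    by_cases hc : (c : ℕ) < p + r
    · rw [show c = Fin.castAdd (p + r) ⟨c, hc⟩ from Fin.ext rfl]
      by_cases ha : (c : ℕ) < p
      · have : (⟨c, hc⟩ : Fin (p + r)) = Fin.castAdd r ⟨c, ha⟩ := Fin.ext rfl
        rw [this]; exact gQ _
      · have : (⟨c, hc⟩ : Fin (p + r)) = Fin.natAdd p ⟨c - p, by omega⟩ := Fin.ext (by simp only [Fin.natAdd_mk]; omega)
        rw [this]; exact gP _
    · rw [show c = Fin.natAdd (p + r) ⟨c - (p + r), by omega⟩ from Fin.ext (by simp only [Fin.natAdd_mk]; omega)]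
      by_cases ha : (c : ℕ) - (p + r) < p
      · have : (⟨c - (p + r), by omega⟩ : Fin (p + r)) = Fin.castAdd r ⟨c - (p + r), ha⟩ := Fin.ext rfl
        rw [this]; exact gC _
      · have : (⟨c - (p + r), by omega⟩ : Fin (p + r)) = Fin.natAdd p ⟨c - (p + r) - p, by omega⟩ :=
          Fin.ext (by simp only [Fin.natAdd_mk]; omega)
        rw [this]; exact gD _
  have hcard : Fintype.card (Fin ((p + r) + (p + r))) = finrank K V := by rw [Fintype.card_fin, hV]
  let bV : Basis (Fin ((p + r) + (p + r))) K V := basisOfLinearIndependentOfCardEqFinrank' _ hli hcard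
  have hbV : ⇑bV = Fin.append ℓf mf := coe_basisOfLinearIndependentOfCardEqFinrank' _ _ _
  have hℓ : ∀ a, ℓ bV a = ℓf a := fun a => by rw [ℓ, hbV, Fin.append_left]
  have hm : ∀ a, m bV a = mf a := fun a => by rw [m, hbV, Fin.append_right]
  have hliℓ : LinearIndependent K ℓf := by
    have h := hli.comp (Fin.castAdd (p + r)) (Fin.castAdd_injective _ _)
    have he : Fin.append ℓf mf ∘ Fin.castAdd (p + r) = ℓf := funext fun a => Fin.append_left ℓf mf a
    rwa [he] at h
  refine ⟨bV, ?_, ?_, ?_⟩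
  · -- `Lsp bV = L`
    unfold Lsp
    refine Submodule.eq_of_le_of_finrank_eq (Submodule.span_le.mpr ?_) ?_
    · rintro _ ⟨a, rfl⟩; rw [hℓ]; exact hℓL a
    · rw [show ℓ bV = ℓf from funext hℓ, finrank_span_eq_card hliℓ, Fintype.card_fin, hL]
  · intro a ha
    rw [hℓ, hm, show a = Fin.castAdd r ⟨a, ha⟩ from Fin.ext rfl]
    simp only [ℓf, mf, Fin.append_left]
    exact ⟨(bQ _).2.2, (bC _ : ↥P).2⟩
  · intro a ha
    rw [hℓ, hm, show a = Fin.natAdd p ⟨a - p, by omega⟩ from Fin.ext (by simp only [Fin.natAdd_mk]; omega)]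
    simp only [ℓf, mf, Fin.append_right]
    exact ⟨(bP _).2.2, (bD _ : ↥Q).2⟩

/-- **EVERY WEIL BLOCK DATUM CARRIES A NON-DEGENERATE WEIL 2-VECTOR:** under the hypotheses of `exists_adapted_basis_free` there is
`Θ` in the span of the Weil generating set of `(L; P, Q)` with `ι(L) ⊆ span{ι_φ Θ : φ ∈ Ann L}` (namely `Σ_a ℓ_a ∧ m_a` of a free
adapted frame). [cite: BourbakiAlgebre1a3, Ch. III §11 no. 9] -/
theorem exists_weilGen_twoVector [FiniteDimensional K V] {p r : ℕ} {L P Q : Submodule K V}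
    (hV : finrank K V = (p + r) + (p + r)) (hPQ : Disjoint P Q) (hL : finrank K L = p + r)
    (hLQ : finrank K ↥(L ⊓ Q) = p) (hLP : finrank K ↥(L ⊓ P) = r) (hP : finrank K ↥P = p + r)
    (hQ : finrank K ↥Q = p + r) :
    ∃ Θ : ExteriorAlgebra K V,
      Θ ∈ Submodule.span K
        {z : ExteriorAlgebra K V | ∃ x l : V, ((x ∈ P ∧ l ∈ L ⊓ Q) ∨ (x ∈ Q ∧ l ∈ L ⊓ P)) ∧ z = ι K x * ι K l} ∧
      ∀ l ∈ (L : Set V), ι K l ∈ Submodule.span K {y : ExteriorAlgebra K V |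
        ∃ φ ∈ {θ : Module.Dual K V | ∀ q ∈ L, θ q = 0}, y = contractLeft φ Θ} := by
  obtain ⟨bV, hLsp, hlt, hge⟩ := exists_adapted_basis_free hV hPQ hL hLQ hLP hP hQ
  subst hLsp
  exact ⟨∑ a : Fin (p + r), ι K (ℓ bV a) * ι K (m bV a),
    sum_ι_mul_ι_mem_span_weilGen bV P Q (fun a ha => (hlt a ha).1) (fun a ha => (hlt a ha).2)
      (fun a ha => (hge a ha).1) (fun a ha => (hge a ha).2),
    fun l hl => ι_mem_span_contractLeft_sum bV hl⟩

/-! ### 2. The pure Weil classes of abstract blocks `(L; P, Q)` — no polarisation -/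

/-- **pure Weil class of abstract blocks, every interior degree** (type `(n,n)`, char `0`; `1 ≤ k ≤ 2n - 1`): for `w₊`, `w₋` non-zero
in the top lines of `P`, `Q`: `dim S_k(w₊ + w₋) = 2·C(2n,k)` — NO polarisation hypothesis. [cite: BuchweitzFlenner2008HH, Prop. 6.4.4] -/
theorem finrank_S_pureWeilBlocks_all [FiniteDimensional K V] [CharZero K] {n : ℕ} {L P Q : Submodule K V}
    {wP wQ : ExteriorAlgebra K V} (hV : finrank K V = (n + n) + (n + n)) (hPQ : Disjoint P Q)
    (hL : finrank K L = n + n) (hLQ : finrank K ↥(L ⊓ Q) = n) (hLP : finrank K ↥(L ⊓ P) = n)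
    (hP : finrank K ↥P = n + n) (hQ : finrank K ↥Q = n + n)
    (hwP : wP ∈ ((⋀[K]^(finrank K ↥P) ↥P).map (ExteriorAlgebra.map P.subtype).toLinearMap)) (hwP0 : wP ≠ 0)
    (hwQ : wQ ∈ ((⋀[K]^(finrank K ↥Q) ↥Q).map (ExteriorAlgebra.map Q.subtype).toLinearMap)) (hwQ0 : wQ ≠ 0)
    {k : ℕ} (hk1 : 1 ≤ k) (hk : k + 1 ≤ n + n) :
    finrank K ↥(S K L k (wP + wQ)) = 2 * (n + n).choose k := by
  obtain ⟨Θ, hΘ, hnd⟩ := exists_weilGen_twoVector hV hPQ hL hLQ hLP hP hQ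
  exact finrank_S_pureWeilDatum_all hV hPQ hL hLQ hLP hP hQ hΘ hnd hwP hwP0 hwQ hwQ0 hk1 hk

/-- pure Weil class of abstract blocks, edge row `0`: `dim S_0(w₊ + w₋) = 1`. [cite: BuchweitzFlenner2008HH, Prop. 6.4.4] -/
theorem finrank_S_pureWeilBlocks_zero [FiniteDimensional K V] [CharZero K] {n : ℕ} {L P Q : Submodule K V}
    {wP wQ : ExteriorAlgebra K V} (hV : finrank K V = (n + n) + (n + n)) (hPQ : Disjoint P Q)
    (hL : finrank K L = n + n) (hLQ : finrank K ↥(L ⊓ Q) = n) (hLP : finrank K ↥(L ⊓ P) = n)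
    (hP : finrank K ↥P = n + n) (hQ : finrank K ↥Q = n + n)
    (hwP : wP ∈ ((⋀[K]^(finrank K ↥P) ↥P).map (ExteriorAlgebra.map P.subtype).toLinearMap)) (hwP0 : wP ≠ 0)
    (hwQ : wQ ∈ ((⋀[K]^(finrank K ↥Q) ↥Q).map (ExteriorAlgebra.map Q.subtype).toLinearMap)) (hwQ0 : wQ ≠ 0)
    (hn : 1 ≤ n) :
    finrank K ↥(S K L 0 (wP + wQ)) = 1 := by
  obtain ⟨Θ, hΘ, hnd⟩ := exists_weilGen_twoVector hV hPQ hL hLQ hLP hP hQ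
  exact finrank_S_pureWeilDatum_zero hV hPQ hL hLQ hLP hP hQ hΘ hnd hwP hwP0 hwQ hwQ0 hn

/-- pure Weil class of abstract blocks, edge row `2n`: `dim S_{2n}(w₊ + w₋) = 1` (`n ≥ 1`). [cite: BuchweitzFlenner2008HH, Prop. 6.4.4] -/
theorem finrank_S_pureWeilBlocks_top [FiniteDimensional K V] [CharZero K] {n : ℕ} {L P Q : Submodule K V}
    {wP wQ : ExteriorAlgebra K V} (hV : finrank K V = (n + n) + (n + n)) (hPQ : Disjoint P Q)
    (hL : finrank K L = n + n) (hLQ : finrank K ↥(L ⊓ Q) = n) (hLP : finrank K ↥(L ⊓ P) = n)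
    (hP : finrank K ↥P = n + n) (hQ : finrank K ↥Q = n + n)
    (hwP : wP ∈ ((⋀[K]^(finrank K ↥P) ↥P).map (ExteriorAlgebra.map P.subtype).toLinearMap)) (hwP0 : wP ≠ 0)
    (hwQ : wQ ∈ ((⋀[K]^(finrank K ↥Q) ↥Q).map (ExteriorAlgebra.map Q.subtype).toLinearMap)) (hwQ0 : wQ ≠ 0)
    (hn : 1 ≤ n) :
    finrank K ↥(S K L (n + n) (wP + wQ)) = 1 := by
  obtain ⟨Θ, hΘ, hnd⟩ := exists_weilGen_twoVector hV hPQ hL hLQ hLP hP hQ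
  exact finrank_S_pureWeilDatum_top hV hPQ hL hLQ hLP hP hQ hΘ hnd hwP hwP0 hwQ hwQ0 hn

/-- **pure one-sided class `w₊` of abstract blocks, every degree `0 ≤ k ≤ 2n`:** `dim S_k(w₊) = C(2n,k)` (`n ≥ 1`) — NO polarisation.
[cite: BuchweitzFlenner2008HH, Prop. 6.4.4] -/
theorem finrank_S_pureWeilBlocks_one_all [FiniteDimensional K V] [CharZero K] {n : ℕ} {L P Q : Submodule K V}
    {wP : ExteriorAlgebra K V} (hV : finrank K V = (n + n) + (n + n)) (hPQ : Disjoint P Q)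
    (hL : finrank K L = n + n) (hLQ : finrank K ↥(L ⊓ Q) = n) (hLP : finrank K ↥(L ⊓ P) = n)
    (hP : finrank K ↥P = n + n) (hQ : finrank K ↥Q = n + n)
    (hwP : wP ∈ ((⋀[K]^(finrank K ↥P) ↥P).map (ExteriorAlgebra.map P.subtype).toLinearMap)) (hwP0 : wP ≠ 0)
    (hn : 1 ≤ n) {k : ℕ} (hk : k ≤ n + n) :
    finrank K ↥(S K L k wP) = (n + n).choose k := by
  obtain ⟨Θ, hΘ, hnd⟩ := exists_weilGen_twoVector hV hPQ hL hLQ hLP hP hQ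
  exact finrank_S_pureWeilDatum_one_all hV hPQ hL hLQ hLP hP hQ hΘ hnd hwP hwP0 hn hk

/-- **pure one-sided class `w₋` of abstract blocks, every degree `0 ≤ k ≤ 2n`:** `dim S_k(w₋) = C(2n,k)` (`n ≥ 1`) — NO polarisation.
[cite: BuchweitzFlenner2008HH, Prop. 6.4.4] -/
theorem finrank_S_pureWeilBlocks_low_all [FiniteDimensional K V] [CharZero K] {n : ℕ} {L P Q : Submodule K V}
    {wQ : ExteriorAlgebra K V} (hV : finrank K V = (n + n) + (n + n)) (hPQ : Disjoint P Q)
    (hL : finrank K L = n + n) (hLQ : finrank K ↥(L ⊓ Q) = n) (hLP : finrank K ↥(L ⊓ P) = n)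
    (hP : finrank K ↥P = n + n) (hQ : finrank K ↥Q = n + n)
    (hwQ : wQ ∈ ((⋀[K]^(finrank K ↥Q) ↥Q).map (ExteriorAlgebra.map Q.subtype).toLinearMap)) (hwQ0 : wQ ≠ 0)
    (hn : 1 ≤ n) {k : ℕ} (hk : k ≤ n + n) :
    finrank K ↥(S K L k wQ) = (n + n).choose k := by
  obtain ⟨Θ, hΘ, hnd⟩ := exists_weilGen_twoVector hV hPQ hL hLQ hLP hP hQ
  exact finrank_S_pureWeilDatum_low_all hV hPQ hL hLQ hLP hP hQ hΘ hnd hwQ hwQ0 hn hk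

/-- **Euler pin of the pure Weil class of abstract blocks:** `Σ_{k ≤ 2n} (-1)^k dim S_k(w₊ + w₋) = -2` (`n ≥ 1`) — NO polarisation.
[cite: BuchweitzFlenner2008HH, Prop. 6.4.4] -/
theorem alternating_sum_finrank_S_pureWeilBlocks [FiniteDimensional K V] [CharZero K] {n : ℕ} {L P Q : Submodule K V}
    {wP wQ : ExteriorAlgebra K V} (hV : finrank K V = (n + n) + (n + n)) (hPQ : Disjoint P Q)
    (hL : finrank K L = n + n) (hLQ : finrank K ↥(L ⊓ Q) = n) (hLP : finrank K ↥(L ⊓ P) = n)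
    (hP : finrank K ↥P = n + n) (hQ : finrank K ↥Q = n + n)
    (hwP : wP ∈ ((⋀[K]^(finrank K ↥P) ↥P).map (ExteriorAlgebra.map P.subtype).toLinearMap)) (hwP0 : wP ≠ 0)
    (hwQ : wQ ∈ ((⋀[K]^(finrank K ↥Q) ↥Q).map (ExteriorAlgebra.map Q.subtype).toLinearMap)) (hwQ0 : wQ ≠ 0)
    (hn : 1 ≤ n) :
    ∑ k ∈ Finset.range (n + n + 1), (-1 : ℤ) ^ k * (finrank K ↥(S K L k (wP + wQ)) : ℤ) = -2 := by
  obtain ⟨Θ, hΘ, hnd⟩ := exists_weilGen_twoVector hV hPQ hL hLQ hLP hP hQ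
  exact alternating_sum_finrank_S_pureWeilDatum hV hPQ hL hLQ hLP hP hQ hΘ hnd hwP hwP0 hwQ hwQ0 hn

end Free
/-! ### 3. The Weil line classes on the real carrier — NO polarisation hypothesis -/
section RealCarrier
variable {A : AbelianVariety ℂ}

/-- **THE WEIL LINE CLASSES ON THE REAL CARRIER, every interior degree, NO POLARISATION:** `A` of dimension `2n`,
`φ ≫ φ = -(d • 𝟙 A)`, `d ≥ 1`, `P, Q` the `±i√d`-eigenspaces of `φ*` on `H¹(A; ℂ)`, `dim (P ⊓ H^{1,0}) = n`, and non-zero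
`c₊ ∈ weilClassesPlus A φ n d`, `c₋ ∈ weilClassesMinus A φ n d` — NOTHING ELSE: `dim S_k(ĉ₊ + ĉ₋) = 2·C(2n,k)` for `1 ≤ k ≤ 2n - 1`.
[cite: BuchweitzFlenner2008HH, Prop. 6.4.4] [cite: vanGeemen1994HodgeAV, 4.9] -/
theorem finrank_S_weilLineClasses_all (hA : IsSmoothProjective A.dim A.X) {n d : ℕ} (hdim : A.dim = n + n) (hd : 0 < d)
    {φ : A ⟶ A} (hφ : φ ≫ φ = -(d • 𝟙 A)) {P Q : Submodule ℂ (complexBetti A.X 1)}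
    (hP : P = Module.End.eigenspace (complexBetti.map φ.hom.hom.hom 1).hom (Complex.I * (Real.sqrt d : ℂ)))
    (hQ : Q = Module.End.eigenspace (complexBetti.map φ.hom.hom.hom 1).hom (-(Complex.I * (Real.sqrt d : ℂ))))
    (hp : finrank ℂ ↥(P ⊓ hodgeOneZero hA) = n)
    {cP : complexBetti A.X (2 * n)} (hcP : cP ∈ weilClassesPlus A φ n d) (hcP0 : cP ≠ 0)
    {cQ : complexBetti A.X (2 * n)} (hcQ : cQ ∈ weilClassesMinus A φ n d) (hcQ0 : cQ ≠ 0)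
    {k : ℕ} (hk1 : 1 ≤ k) (hk : k + 1 ≤ n + n) :
    finrank ℂ ↥(S ℂ (hodgeZeroOne hA) k
        ((⋀[ℂ]^(2 * n) (complexBetti A.X 1)).subtype ((abelianVarietyCohomologyExteriorH1_holds.equiv A (2 * n)).symm cP) +
          (⋀[ℂ]^(2 * n) (complexBetti A.X 1)).subtype ((abelianVarietyCohomologyExteriorH1_holds.equiv A (2 * n)).symm cQ))) =
      2 * (n + n).choose k := by
  haveI : Module.Finite ℂ (complexBetti A.X 1) := abelianVarietyCohomologyExteriorH1_holds.finite_one A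
  obtain ⟨hV, hPQ, hL, hLQ, hLP, hP2, hQ2⟩ := weilBlocks_of_sq_eq_neg hA hdim hd hφ hP hQ hp
  exact finrank_S_pureWeilBlocks_all hV hPQ hL hLQ hLP hP2 hQ2
    (exteriorOf_mem_topLine_of_mem_weilClassesPlus hdim hd hφ hP hcP) (exteriorOf_ne_zero hcP0)
    (exteriorOf_mem_topLine_of_mem_weilClassesMinus hdim hd hφ hQ hcQ) (exteriorOf_ne_zero hcQ0) hk1 hk

/-- the Weil line classes on the real carrier, edge row `0` (`n ≥ 1`), no polarisation: `dim S_0(ĉ₊ + ĉ₋) = 1`.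
[cite: BuchweitzFlenner2008HH, Prop. 6.4.4] -/
theorem finrank_S_weilLineClasses_zero (hA : IsSmoothProjective A.dim A.X) {n d : ℕ} (hdim : A.dim = n + n) (hd : 0 < d)
    {φ : A ⟶ A} (hφ : φ ≫ φ = -(d • 𝟙 A)) {P Q : Submodule ℂ (complexBetti A.X 1)}
    (hP : P = Module.End.eigenspace (complexBetti.map φ.hom.hom.hom 1).hom (Complex.I * (Real.sqrt d : ℂ)))
    (hQ : Q = Module.End.eigenspace (complexBetti.map φ.hom.hom.hom 1).hom (-(Complex.I * (Real.sqrt d : ℂ))))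
    (hp : finrank ℂ ↥(P ⊓ hodgeOneZero hA) = n)
    {cP : complexBetti A.X (2 * n)} (hcP : cP ∈ weilClassesPlus A φ n d) (hcP0 : cP ≠ 0)
    {cQ : complexBetti A.X (2 * n)} (hcQ : cQ ∈ weilClassesMinus A φ n d) (hcQ0 : cQ ≠ 0) (hn : 1 ≤ n) :
    finrank ℂ ↥(S ℂ (hodgeZeroOne hA) 0
        ((⋀[ℂ]^(2 * n) (complexBetti A.X 1)).subtype ((abelianVarietyCohomologyExteriorH1_holds.equiv A (2 * n)).symm cP) +
          (⋀[ℂ]^(2 * n) (complexBetti A.X 1)).subtype ((abelianVarietyCohomologyExteriorH1_holds.equiv A (2 * n)).symm cQ))) = 1 := by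
  haveI : Module.Finite ℂ (complexBetti A.X 1) := abelianVarietyCohomologyExteriorH1_holds.finite_one A
  obtain ⟨hV, hPQ, hL, hLQ, hLP, hP2, hQ2⟩ := weilBlocks_of_sq_eq_neg hA hdim hd hφ hP hQ hp
  exact finrank_S_pureWeilBlocks_zero hV hPQ hL hLQ hLP hP2 hQ2
    (exteriorOf_mem_topLine_of_mem_weilClassesPlus hdim hd hφ hP hcP) (exteriorOf_ne_zero hcP0)
    (exteriorOf_mem_topLine_of_mem_weilClassesMinus hdim hd hφ hQ hcQ) (exteriorOf_ne_zero hcQ0) hn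

/-- the Weil line classes on the real carrier, edge row `2n` (`n ≥ 1`), no polarisation: `dim S_{2n}(ĉ₊ + ĉ₋) = 1`.
[cite: BuchweitzFlenner2008HH, Prop. 6.4.4] -/
theorem finrank_S_weilLineClasses_top (hA : IsSmoothProjective A.dim A.X) {n d : ℕ} (hdim : A.dim = n + n) (hd : 0 < d)
    {φ : A ⟶ A} (hφ : φ ≫ φ = -(d • 𝟙 A)) {P Q : Submodule ℂ (complexBetti A.X 1)}
    (hP : P = Module.End.eigenspace (complexBetti.map φ.hom.hom.hom 1).hom (Complex.I * (Real.sqrt d : ℂ)))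
    (hQ : Q = Module.End.eigenspace (complexBetti.map φ.hom.hom.hom 1).hom (-(Complex.I * (Real.sqrt d : ℂ))))
    (hp : finrank ℂ ↥(P ⊓ hodgeOneZero hA) = n)
    {cP : complexBetti A.X (2 * n)} (hcP : cP ∈ weilClassesPlus A φ n d) (hcP0 : cP ≠ 0)
    {cQ : complexBetti A.X (2 * n)} (hcQ : cQ ∈ weilClassesMinus A φ n d) (hcQ0 : cQ ≠ 0) (hn : 1 ≤ n) :
    finrank ℂ ↥(S ℂ (hodgeZeroOne hA) (n + n)
        ((⋀[ℂ]^(2 * n) (complexBetti A.X 1)).subtype ((abelianVarietyCohomologyExteriorH1_holds.equiv A (2 * n)).symm cP) +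
          (⋀[ℂ]^(2 * n) (complexBetti A.X 1)).subtype ((abelianVarietyCohomologyExteriorH1_holds.equiv A (2 * n)).symm cQ))) = 1 := by
  haveI : Module.Finite ℂ (complexBetti A.X 1) := abelianVarietyCohomologyExteriorH1_holds.finite_one A
  obtain ⟨hV, hPQ, hL, hLQ, hLP, hP2, hQ2⟩ := weilBlocks_of_sq_eq_neg hA hdim hd hφ hP hQ hp
  exact finrank_S_pureWeilBlocks_top hV hPQ hL hLQ hLP hP2 hQ2
    (exteriorOf_mem_topLine_of_mem_weilClassesPlus hdim hd hφ hP hcP) (exteriorOf_ne_zero hcP0)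
    (exteriorOf_mem_topLine_of_mem_weilClassesMinus hdim hd hφ hQ hcQ) (exteriorOf_ne_zero hcQ0) hn

/-- **A SINGLE WEIL LINE CLASS `c₊ ∈ E₊` ON THE REAL CARRIER, every degree `0 ≤ k ≤ 2n`, NO POLARISATION:** `dim S_k(ĉ₊) = C(2n,k)`.
[cite: BuchweitzFlenner2008HH, Prop. 6.4.4] [cite: vanGeemen1994HodgeAV, 4.9] -/
theorem finrank_S_weilLineClass_plus_all (hA : IsSmoothProjective A.dim A.X) {n d : ℕ} (hdim : A.dim = n + n) (hd : 0 < d)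
    {φ : A ⟶ A} (hφ : φ ≫ φ = -(d • 𝟙 A)) {P Q : Submodule ℂ (complexBetti A.X 1)}
    (hP : P = Module.End.eigenspace (complexBetti.map φ.hom.hom.hom 1).hom (Complex.I * (Real.sqrt d : ℂ)))
    (hQ : Q = Module.End.eigenspace (complexBetti.map φ.hom.hom.hom 1).hom (-(Complex.I * (Real.sqrt d : ℂ))))
    (hp : finrank ℂ ↥(P ⊓ hodgeOneZero hA) = n)
    {cP : complexBetti A.X (2 * n)} (hcP : cP ∈ weilClassesPlus A φ n d) (hcP0 : cP ≠ 0) (hn : 1 ≤ n) {k : ℕ}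
    (hk : k ≤ n + n) :
    finrank ℂ ↥(S ℂ (hodgeZeroOne hA) k
        ((⋀[ℂ]^(2 * n) (complexBetti A.X 1)).subtype ((abelianVarietyCohomologyExteriorH1_holds.equiv A (2 * n)).symm cP))) =
      (n + n).choose k := by
  haveI : Module.Finite ℂ (complexBetti A.X 1) := abelianVarietyCohomologyExteriorH1_holds.finite_one A
  obtain ⟨hV, hPQ, hL, hLQ, hLP, hP2, hQ2⟩ := weilBlocks_of_sq_eq_neg hA hdim hd hφ hP hQ hp
  exact finrank_S_pureWeilBlocks_one_all hV hPQ hL hLQ hLP hP2 hQ2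
    (exteriorOf_mem_topLine_of_mem_weilClassesPlus hdim hd hφ hP hcP) (exteriorOf_ne_zero hcP0) hn hk

/-- **A SINGLE WEIL LINE CLASS `c₋ ∈ E₋` ON THE REAL CARRIER, every degree `0 ≤ k ≤ 2n`, NO POLARISATION:** `dim S_k(ĉ₋) = C(2n,k)`.
[cite: BuchweitzFlenner2008HH, Prop. 6.4.4] [cite: vanGeemen1994HodgeAV, 4.9] -/
theorem finrank_S_weilLineClass_minus_all (hA : IsSmoothProjective A.dim A.X) {n d : ℕ} (hdim : A.dim = n + n) (hd : 0 < d)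
    {φ : A ⟶ A} (hφ : φ ≫ φ = -(d • 𝟙 A)) {P Q : Submodule ℂ (complexBetti A.X 1)}
    (hP : P = Module.End.eigenspace (complexBetti.map φ.hom.hom.hom 1).hom (Complex.I * (Real.sqrt d : ℂ)))
    (hQ : Q = Module.End.eigenspace (complexBetti.map φ.hom.hom.hom 1).hom (-(Complex.I * (Real.sqrt d : ℂ))))
    (hp : finrank ℂ ↥(P ⊓ hodgeOneZero hA) = n)
    {cQ : complexBetti A.X (2 * n)} (hcQ : cQ ∈ weilClassesMinus A φ n d) (hcQ0 : cQ ≠ 0) (hn : 1 ≤ n) {k : ℕ}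
    (hk : k ≤ n + n) :
    finrank ℂ ↥(S ℂ (hodgeZeroOne hA) k
        ((⋀[ℂ]^(2 * n) (complexBetti A.X 1)).subtype ((abelianVarietyCohomologyExteriorH1_holds.equiv A (2 * n)).symm cQ))) =
      (n + n).choose k := by
  haveI : Module.Finite ℂ (complexBetti A.X 1) := abelianVarietyCohomologyExteriorH1_holds.finite_one A
  obtain ⟨hV, hPQ, hL, hLQ, hLP, hP2, hQ2⟩ := weilBlocks_of_sq_eq_neg hA hdim hd hφ hP hQ hp
  exact finrank_S_pureWeilBlocks_low_all hV hPQ hL hLQ hLP hP2 hQ2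
    (exteriorOf_mem_topLine_of_mem_weilClassesMinus hdim hd hφ hQ hcQ) (exteriorOf_ne_zero hcQ0) hn hk

/-- **EULER PIN OF THE WEIL LINE CLASSES ON THE REAL CARRIER, NO POLARISATION:** `Σ_{k ≤ 2n} (-1)^k dim S_k(ĉ₊ + ĉ₋) = -2`
(`n ≥ 1`). [cite: BuchweitzFlenner2008HH, Prop. 6.4.4] [cite: vanGeemen1994HodgeAV, 4.9] -/
theorem alternating_sum_finrank_S_weilLineClasses (hA : IsSmoothProjective A.dim A.X) {n d : ℕ} (hdim : A.dim = n + n)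
    (hd : 0 < d) {φ : A ⟶ A} (hφ : φ ≫ φ = -(d • 𝟙 A)) {P Q : Submodule ℂ (complexBetti A.X 1)}
    (hP : P = Module.End.eigenspace (complexBetti.map φ.hom.hom.hom 1).hom (Complex.I * (Real.sqrt d : ℂ)))
    (hQ : Q = Module.End.eigenspace (complexBetti.map φ.hom.hom.hom 1).hom (-(Complex.I * (Real.sqrt d : ℂ))))
    (hp : finrank ℂ ↥(P ⊓ hodgeOneZero hA) = n)
    {cP : complexBetti A.X (2 * n)} (hcP : cP ∈ weilClassesPlus A φ n d) (hcP0 : cP ≠ 0)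
    {cQ : complexBetti A.X (2 * n)} (hcQ : cQ ∈ weilClassesMinus A φ n d) (hcQ0 : cQ ≠ 0) (hn : 1 ≤ n) :
    ∑ k ∈ Finset.range (n + n + 1), (-1 : ℤ) ^ k *
        (finrank ℂ ↥(S ℂ (hodgeZeroOne hA) k
          ((⋀[ℂ]^(2 * n) (complexBetti A.X 1)).subtype ((abelianVarietyCohomologyExteriorH1_holds.equiv A (2 * n)).symm cP) +
            (⋀[ℂ]^(2 * n) (complexBetti A.X 1)).subtype ((abelianVarietyCohomologyExteriorH1_holds.equiv A (2 * n)).symm cQ))) : ℤ) =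
      -2 :=
  alternating_sum_pureW_row hn _ (finrank_S_weilLineClasses_zero hA hdim hd hφ hP hQ hp hcP hcP0 hcQ hcQ0 hn)
    (finrank_S_weilLineClasses_top hA hdim hd hφ hP hQ hp hcP hcP0 hcQ hcQ0 hn)
    (fun _ hk1 hk => finrank_S_weilLineClasses_all hA hdim hd hφ hP hQ hp hcP hcP0 hcQ hcQ0 hk1 hk)

end RealCarrier

end Summit.Ventures.HSemireg.WeilFrame
end
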